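import Summits.CriticalPhenomena.SAWScalingLimit.Theses.SAWRingGibbsDescent

/-!
# Birth skeleton (BC3) of the crux `PinLocality` (stmt-CriticalPhenomena-17606, route SAWRingGibbsDescent;
child 1/3 of `DomainContinuity`, line `common-pin-triangle`)

`PinLocality` moves BOTH pins of the critical SAW of `W_n` at once. First cut: move one pin at a time.

* `stub_startPinLocality` — start pin moved (`x ↦ x'`, both within `ρ` of the mark `a`), end pin `y` fixed;
* `stub_endPinLocality` — end pin moved (`y ↦ y'`), start pin fixed (the reversal twin of the first: SAW
  reversal `γ ↦ γ⁻¹` maps `law Ω δ a b` to `law Ω δ b a` and is a homeomorphism of `CurveClass ℂ`, so a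
  prover proves ONE mark-symmetric statement and derives both);
* `PinLocality_of` — `(x, y) ↦ (x', y) ↦ (x', y')`, ε/2 + ε/2; the intermediate pair `(x', y)` is joined
  because `x' ~ x ~ y` (the same-component guard of the crux is exactly what licenses the pivot).
-/

noncomputable section

namespace Summit.CriticalPhenomena.SAWScalingLimit.Cruxes.PinLocality.Birth

open Filter Topology
open Summit.CriticalPhenomena.SAWScalingLimit.Theses.SAWRingGibbsDescent (PinLocality)

/-- Stub 1: start-pin locality (end pin fixed), uniform along the wall family and in the mesh. [folklore] -/
theorem stub_startPinLocality :
    ∀ (D : Literature.Probability.RandomPlanarGeometry.DobrushinDomain), (let IsWall : Literature.Probability.RandomPlanarGeometry.CurveClass ℂ → Literature.Probability.RandomPlanarGeometry.DobrushinDomain → Prop := fun η W => W.carrier ⊆ D.carrier ∧ W.pt 0 = D.pt 0 ∧ W.pt 1 = D.pt 1 ∧ frontier W.carrier = η.range ∪ D.arc 1; ∀ (ηs : ℕ → Literature.Probability.RandomPlanarGeometry.CurveClass ℂ) (η : Literature.Probability.RandomPlanarGeometry.CurveClass ℂ) (Ws : ℕ → Literature.Probability.RandomPlanarGeometry.DobrushinDomain)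 (W : Literature.Probability.RandomPlanarGeometry.DobrushinDomain), (∀ n, IsWall (ηs n) (Ws n)) → IsWall η W → η ∈ Literature.Probability.RandomPlanarGeometry.CurveClass.simple → Filter.Tendsto ηs Filter.atTop (nhds η) → ∀ f : BoundedContinuousFunction (Literature.Probability.RandomPlanarGeometry.CurveClass ℂ) ℝ, ∀ ε > (0 : ℝ), ∃ ρ : ℝ, 0 < ρ ∧ ∃ N : ℕ, ∃ δ₀ : ℝ, 0 < δ₀ ∧ ∀ n ≥ N, ∀ δ ∈ Set.Ioo (0 : ℝ) δ₀, ∀ x x' y : Literature.Probability.LatticeModels.Site 2, dist (Literature.Probability.LatticeModels.meshPoint δ x) (D.pt 0) < ρ → dist (Literature.Probability.LatticeModels.meshPoint δ x') (D.pt 0) < ρ → dist (Literature.Probability.LatticeModels.meshPoint δ y) (D.pt 1) < ρ → (Literature.Probability.LatticeModels.discreteDomainGraph (Ws n).carrier δ).Reachable x y → (Literature.Probability.LatticeModels.discreteDomainGraph (Ws n).carrier δ).Reachable x' y → |(∫ γ, f γ.curve ∂(Literature.Probability.RandomPlanarGeometry.SAW.law (Ws n).carrier δ x y)) - ∫ γ,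 f γ.curve ∂(Literature.Probability.RandomPlanarGeometry.SAW.law (Ws n).carrier δ x' y)| < ε) := by
  sorry

/-- Stub 2: end-pin locality (start pin fixed), uniform along the wall family and in the mesh. [folklore] -/
theorem stub_endPinLocality :
    ∀ (D : Literature.Probability.RandomPlanarGeometry.DobrushinDomain), (let IsWall : Literature.Probability.RandomPlanarGeometry.CurveClass ℂ → Literature.Probability.RandomPlanarGeometry.DobrushinDomain → Prop := fun η W => W.carrier ⊆ D.carrier ∧ W.pt 0 = D.pt 0 ∧ W.pt 1 = D.pt 1 ∧ frontier W.carrier = η.range ∪ D.arc 1; ∀ (ηs : ℕ → Literature.Probability.RandomPlanarGeometry.CurveClass ℂ) (η : Literature.Probability.RandomPlanarGeometry.CurveClass ℂ) (Ws : ℕ → Literature.Probability.RandomPlanarGeometry.DobrushinDomain) (W : Literature.Probability.RandomPlanarGeometry.DobrushinDomain), (∀ n, IsWall (ηs n) (Ws n)) → IsWall η W → η ∈ Literature.Probability.RandomPlanarGeometry.CurveClass.simple → Filter.Tendsto ηs Filter.atTop (nhds η) → ∀ f : BoundedContinuousFunction (Literature.Probability.RandomPlanarGeometry.CurveClass ℂ)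 ℝ, ∀ ε > (0 : ℝ), ∃ ρ : ℝ, 0 < ρ ∧ ∃ N : ℕ, ∃ δ₀ : ℝ, 0 < δ₀ ∧ ∀ n ≥ N, ∀ δ ∈ Set.Ioo (0 : ℝ) δ₀, ∀ x y y' : Literature.Probability.LatticeModels.Site 2, dist (Literature.Probability.LatticeModels.meshPoint δ x) (D.pt 0) < ρ → dist (Literature.Probability.LatticeModels.meshPoint δ y) (D.pt 1) < ρ → dist (Literature.Probability.LatticeModels.meshPoint δ y') (D.pt 1) < ρ → (Literature.Probability.LatticeModels.discreteDomainGraph (Ws n).carrier δ).Reachable x y → (Literature.Probability.LatticeModels.discreteDomainGraph (Ws n).carrier δ).Reachable x y' → |(∫ γ, f γ.curve ∂(Literature.Probability.RandomPlanarGeometry.SAW.law (Ws n).carrier δ x y)) - ∫ γ, f γ.curve ∂(Literature.Probability.RandomPlanarGeometry.SAW.law (Ws n).carrier δ x y')| < ε) := by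
  sorry

/-! ## Name-keyed aliases (hypotheses of `PinLocality_of`; see `Cruxes/DomainContinuity/Lines/common_pin_triangle.lean`) -/
namespace __Registered

/-- Alias of the statement of `stub_startPinLocality`, keyed by the stub name. -/
abbrev stub_startPinLocality : Prop :=
  ∀ (D : Literature.Probability.RandomPlanarGeometry.DobrushinDomain), (let IsWall : Literature.Probability.RandomPlanarGeometry.CurveClass ℂ → Literature.Probability.RandomPlanarGeometry.DobrushinDomain → Prop := fun η W => W.carrier ⊆ D.carrier ∧ W.pt 0 = D.pt 0 ∧ W.pt 1 = D.pt 1 ∧ frontier W.carrier = η.range ∪ D.arc 1; ∀ (ηs : ℕ → Literature.Probability.RandomPlanarGeometry.CurveClass ℂ) (η : Literature.Probability.RandomPlanarGeometry.CurveClass ℂ) (Ws : ℕ → Literature.Probability.RandomPlanarGeometry.DobrushinDomain) (W : Literature.Probability.RandomPlanarGeometry.DobrushinDomain), (∀ n, IsWall (ηs n) (Ws n)) → IsWall η W → η ∈ Literature.Probability.RandomPlanarGeometry.CurveClass.simple → Filter.Tendsto ηs Filter.atTop (nhds η) → ∀ f : BoundedContinuousFunction (Literature.Probability.RandomPlanarGeometry.CurveClass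 ℂ) ℝ, ∀ ε > (0 : ℝ), ∃ ρ : ℝ, 0 < ρ ∧ ∃ N : ℕ, ∃ δ₀ : ℝ, 0 < δ₀ ∧ ∀ n ≥ N, ∀ δ ∈ Set.Ioo (0 : ℝ) δ₀, ∀ x x' y : Literature.Probability.LatticeModels.Site 2, dist (Literature.Probability.LatticeModels.meshPoint δ x) (D.pt 0) < ρ → dist (Literature.Probability.LatticeModels.meshPoint δ x') (D.pt 0) < ρ → dist (Literature.Probability.LatticeModels.meshPoint δ y) (D.pt 1) < ρ → (Literature.Probability.LatticeModels.discreteDomainGraph (Ws n).carrier δ).Reachable x y → (Literature.Probability.LatticeModels.discreteDomainGraph (Ws n).carrier δ).Reachable x' y → |(∫ γ, f γ.curve ∂(Literature.Probability.RandomPlanarGeometry.SAW.law (Ws n).carrier δ x y)) - ∫ γ, f γ.curve ∂(Literature.Probability.RandomPlanarGeometry.SAW.law (Ws n).carrier δ x' y)| < ε)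

/-- Alias of the statement of `stub_endPinLocality`, keyed by the stub name. -/
abbrev stub_endPinLocality : Prop :=
  ∀ (D : Literature.Probability.RandomPlanarGeometry.DobrushinDomain), (let IsWall : Literature.Probability.RandomPlanarGeometry.CurveClass ℂ → Literature.Probability.RandomPlanarGeometry.DobrushinDomain → Prop := fun η W => W.carrier ⊆ D.carrier ∧ W.pt 0 = D.pt 0 ∧ W.pt 1 = D.pt 1 ∧ frontier W.carrier = η.range ∪ D.arc 1; ∀ (ηs : ℕ → Literature.Probability.RandomPlanarGeometry.CurveClass ℂ) (η : Literature.Probability.RandomPlanarGeometry.CurveClass ℂ) (Ws : ℕ → Literature.Probability.RandomPlanarGeometry.DobrushinDomain) (W : Literature.Probability.RandomPlanarGeometry.DobrushinDomain), (∀ n, IsWall (ηs n) (Ws n)) → IsWall η W → η ∈ Literature.Probability.RandomPlanarGeometry.CurveClass.simple → Filter.Tendsto ηs Filter.atTop (nhds η) → ∀ f : BoundedContinuousFunction (Literature.Probability.RandomPlanarGeometry.CurveClass ℂ) ℝ, ∀ ε > (0 : ℝ), ∃ ρ : ℝ, 0 < ρ ∧ ∃ N : ℕ, ∃ δ₀ :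 ℝ, 0 < δ₀ ∧ ∀ n ≥ N, ∀ δ ∈ Set.Ioo (0 : ℝ) δ₀, ∀ x y y' : Literature.Probability.LatticeModels.Site 2, dist (Literature.Probability.LatticeModels.meshPoint δ x) (D.pt 0) < ρ → dist (Literature.Probability.LatticeModels.meshPoint δ y) (D.pt 1) < ρ → dist (Literature.Probability.LatticeModels.meshPoint δ y') (D.pt 1) < ρ → (Literature.Probability.LatticeModels.discreteDomainGraph (Ws n).carrier δ).Reachable x y → (Literature.Probability.LatticeModels.discreteDomainGraph (Ws n).carrier δ).Reachable x y' → |(∫ γ, f γ.curve ∂(Literature.Probability.RandomPlanarGeometry.SAW.law (Ws n).carrier δ x y)) - ∫ γ, f γ.curve ∂(Literature.Probability.RandomPlanarGeometry.SAW.law (Ws n).carrier δ x y')| < ε)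

end __Registered

/-- **Composition** (kernel-checked, no `sorry` of its own): start-pin locality and end-pin locality give
`PinLocality` BY NAME — pivot through the pair `(x', y)`, joined since `x' ~ x ~ y`; ε/2 + ε/2 with the
common radius `min ρ₁ ρ₂` and thresholds `max N₁ N₂`, `min δ₁ δ₂`. [folklore] -/
theorem PinLocality_of :
    __Registered.stub_startPinLocality → __Registered.stub_endPinLocality → PinLocality := by
  intro hS hE D
  dsimp only
  intro ηs η Ws W hWs hW hη hconv f ε hε
  have hε2 : (0 : ℝ) < ε / 2 := by positivity
  have hS1 := hS D
  dsimp only at hS1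
  obtain ⟨ρ₁, hρ₁, N₁, δ₁, hδ₁, H₁⟩ := hS1 ηs η Ws W hWs hW hη hconv f (ε / 2) hε2
  have hE1 := hE D
  dsimp only at hE1
  obtain ⟨ρ₂, hρ₂, N₂, δ₂, hδ₂, H₂⟩ := hE1 ηs η Ws W hWs hW hη hconv f (ε / 2) hε2
  refine ⟨min ρ₁ ρ₂, lt_min hρ₁ hρ₂, max N₁ N₂, min δ₁ δ₂, lt_min hδ₁ hδ₂, ?_⟩
  intro n hn δ hδ x y x' y' hx hy hx' hy' hxy hx'y' hxx'
  simp only [ge_iff_le, max_le_iff] at hn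
  obtain ⟨hn₁, hn₂⟩ := hn
  obtain ⟨hδ0, hδ'⟩ := hδ
  simp only [lt_min_iff] at hδ' hx hy hx' hy'
  -- the pivot pair (x', y) is joined: x' ~ x ~ y
  have hx'y : (Literature.Probability.LatticeModels.discreteDomainGraph (Ws n).carrier δ).Reachable x' y :=
    hxx'.symm.trans hxy
  have e1 := H₁ n hn₁ δ ⟨hδ0, hδ'.1⟩ x x' y hx.1 hx'.1 hy.1 hxy hx'y
  have e2 := H₂ n hn₂ δ ⟨hδ0, hδ'.2⟩ x' y y' hx'.2 hy.2 hy'.2 hx'y hx'y'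
  have key : ∀ A B C : ℝ, |A - B| < ε / 2 → |B - C| < ε / 2 → |A - C| < ε := by
    intro A B C h1 h2
    have h : |A - C| ≤ |A - B| + |B - C| := abs_sub_le A B C
    linarith
  exact key _ _ _ e1 e2

/-- WIRING CHECK (an `example`, so no pre-composed witness enters the environment). -/
example : PinLocality := PinLocality_of stub_startPinLocality stub_endPinLocality

end Summit.CriticalPhenomena.SAWScalingLimit.Cruxes.PinLocality.Birth

end
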